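import Literature.AnabelianGeometry.EtaleTheta.BiKummerRootTransportAt

/-!
# [EtTh] §4: TWISTING a fraction-pair and an `N`-th root by a unit — `(s′, s″) ↦ (s′, u ∘ s″)`,
# `(s′_N, s″_N) ↦ (s′_N, ũ ∘ s″_N)` for a unit `ũ` of `B_N` over `u` (R192 sequel (2b), spec abc-iut-L2-d4 10:13:09Z)

S. Mochizuki, *The étale theta function and its Frobenioid-theoretic manifestations*, Publ. RIMS **45** (2009)
[cite: MochizukiEtTh2009, Def 4.1 (i) p.312–313 (PDF pp.86–87); Prop 4.2 (iii)(iv) p.314–315 (PDF pp.88–89); Thm 5.7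
p.329–330 (PDF pp.103–104); Lem 5.8 p.331 (PDF p.105)].

abc-iut cell, layer L2, row R192 sequel (2b) «twistUnit» GO'ed by the spec owner abc-iut-L2-d4 (STATUS 10:13:09Z), seat
abc-iut-f-121.  WHY (abc-iut-L2-d4's analysis, verbatim in substance): after normalising the anchors of a self-equivalence
`Ψ` so that `Ψ s′` re-anchors to `s′` (abc-iut-w5-d245's `D_c := 1`), `Ψ s″` re-anchors to `s″ ≫ u` with `u = D_c⁻¹·D_p`
EXACTLY the unit discrepancy Theorem 5.7 is about ("up to multiplication by a `2l`-th root of unity" — NOT `u = 1`); so the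
transported root `Ψ(R)` (`NthRoot.transportAt`, p437236) is an `N`-th root of the `u`-TWISTED pair `(s′, u ∘ s″)`, and Prop 4.2
(iv) (roots of the SAME pair) compares it with the TWIST of `R` by a unit `ũ` of `B_N` lying over `u` (`ũ ≫ β = β ≫ u`; print:
`(O_K^×)^{1/N} ⊆ O^×(B_N^birat)`, `μ_{2lN}(B_N)`, Lemma 5.8 — abc-iut-L2-d4's binder `hroot₁N`).

WHAT THIS FILE GIVES (definitions + field lemmas, over abc-iut-L2-t3's law-free §4 interface):
* `FractionPair.twistUnit` — `(s′, s″) ↦ (s′, s″ ≫ u)` for `u ∈ O^×(B)`: again a fraction-pair (pre-steps, base-equivalent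
  since `u` is base-identity — PROVED), for the function `f′` named by the binder `hfrac : s′·(u ∘ s″)⁻¹ = f′` (the setting's
  `fracOf` is a law-free field; at abc-iut-L2-t9's model `fracOfModel` this is `f · (s″^* ι u)⁻¹`), with disjoint supports
  `hdisj` (`Div(u ∘ s″) = Div(s″)` at the model);
* `NthRoot.twistUnit` — `(A_N, B_N, α, β, f_N, (s′_N, s″_N)) ↦ (A_N, B_N, α, β, f′_N, (s′_N, ũ ∘ s″_N))` for a unit `ũ` of `B_N`
  OVER `u` (`hover : ũ ≫ β = β ≫ u`): a root of the twisted pair — the commutative square for `s″` PROVED from `hover`; the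
  isometry/degree/Def 4.1 (iv) data of `α, β` unchanged; the birational content of "`ũ` is an `N`-th root of `u`"
  (`f′_N^N = (α′)^* f′`, `(N, H_⊙, (α′)^* f′)`-saturation) carried by the binders `hpow`, `hsat` (model: [FrdI] Def 1.1
  composition law along the degree-`N` isometry `β`, as in abc-iut-L2-d4's `hconst`).
Sequel (proof-only): `Discharge/Sec4RootTransportTwisted.lean` — Prop 4.2 (iv) at the twisted pair applied to
`(R.twistUnit ũ, R.transportAt …)` ⇒ the coherent per-level datum with `D_c = 1`, `D_p = v·ũ` (`v ∈ μ_N(B_N)`).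
HONEST FRAMING: definitions and kernel-checked identities; every [FrdI]/[EtTh] input is a NAMED binder dischargeable at the
model; refereed pre-IUT material; nothing here bears on [IUTchIII] Cor. 3.12 or takes a side; typed ≠ proved for genuine data.
-/

noncomputable section

namespace Literature.AnabelianGeometry.EtaleTheta

open CategoryTheory Opposite Literature.AlgebraicGeometry.Frobenioids

namespace BiKummerSetting

universe u₀ v₀ u v w

variable {K : Type u₀} [Field K] {D₀ : Type u₀} [Category.{v₀} D₀] {V : FrdIMonoidStub.{w}}
  {X₁ : SemiGraphs.TemperedArithmeticGroup.{u₀} K} {T₁ : RealifiedDivisorMonoids (D₀ := D₀) V}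
  {D₁ : Type u} [Category.{v} D₁] {VD₁ : FrdICatStub.{u, v, w} D₁} {S : BiKummerSetting X₁ T₁ D₁ VD₁}

/-! ### §1. [FrdI] bookkeeping: post-composing a pre-step with a unit -/

/-- `s ≫ u` is a pre-step for a pre-step `s` and an automorphism `u`. [cite: MochizukiEtTh2009, Def 4.1 p.312 (PDF p.86)] -/
theorem isPreStep_comp_aut {A B : S.C} {s : A ⟶ B} (hs : S.IsPreStep s) (u : Aut B) : S.IsPreStep (s ≫ u.hom) :=
  PreFrobenioid.IsPreStep.comp S.F hs (PreFrobenioid.isPreStep_of_isIso S.F u.hom)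

/-- `Base(s ≫ u) = Base(s)` for a unit `u ∈ O^×(B)` (base-identity). [cite: MochizukiEtTh2009, Def 4.1 p.313 (PDF p.87)] -/
theorem base_comp_unit {A B : S.C} (s : A ⟶ B) {u : Aut B} (hu : u ∈ S.units B) :
    PreFrobenioid.Base S.F (s ≫ u.hom) = PreFrobenioid.Base S.F s := by
  rw [PreFrobenioid.base_comp, show PreFrobenioid.Base S.F u.hom = 𝟙 _ from hu.1, Category.comp_id]

/-- Base-equivalence is preserved by post-composing the second morphism with a unit.
[cite: MochizukiEtTh2009, Def 4.1 p.312 (PDF p.86)] -/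
theorem baseEquivalent_comp_unit {A B : S.C} {s' s'' : A ⟶ B} (h : PreFrobenioid.BaseEquivalent S.F s' s'')
    {u : Aut B} (hu : u ∈ S.units B) : PreFrobenioid.BaseEquivalent S.F s' (s'' ≫ u.hom) := by
  show PreFrobenioid.Base S.F s' = PreFrobenioid.Base S.F (s'' ≫ u.hom)
  rw [S.base_comp_unit s'' hu]
  exact h

/-! ### §2. `FractionPair.twistUnit`: `(s′, s″) ↦ (s′, u ∘ s″)` -/

namespace FractionPair

/-- **The twist of a fraction-pair by a unit of the codomain** (Def 4.1 (i), p.312–313 (PDF pp.86–87)): for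
`u ∈ O^×(B)`, `(s′, u ∘ s″)` is again a base-equivalent pair of pre-steps `A → B`; it is a fraction-pair for the function
`f′ := s′·(u ∘ s″)⁻¹` named by `hfrac` (the setting's `fracOf` is law-free; `= f·(s″^*ι u)⁻¹` at the model), with disjoint
supports by `hdisj` (`Div(u ∘ s″) = Div(s″)` at the model). [cite: MochizukiEtTh2009, Def 4.1 (i) p.312 (PDF p.86)] -/
def twistUnit {A B : S.C} {f : S.biratUnits A} (P : S.FractionPair f B) (u : Aut B) (hu : u ∈ S.units B)
    {f' : S.biratUnits A}
    (hfrac : S.fracOf P.num (P.den ≫ u.hom) P.isPreStep_num (S.isPreStep_comp_aut P.isPreStep_den u)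
      (S.baseEquivalent_comp_unit P.base_eq hu) = f')
    (hdisj : S.DisjointSupports (S.div P.num) (S.div (P.den ≫ u.hom))) : S.FractionPair f' B where
  num := P.num
  den := P.den ≫ u.hom
  isPreStep_num := P.isPreStep_num
  isPreStep_den := S.isPreStep_comp_aut P.isPreStep_den u
  base_eq := S.baseEquivalent_comp_unit P.base_eq hu
  frac_eq := hfrac
  disjointSupports := hdisj

section

variable {A B : S.C} {f : S.biratUnits A} (P : S.FractionPair f B) (u : Aut B) (hu : u ∈ S.units B)
    {f' : S.biratUnits A}
    (hfrac : S.fracOf P.num (P.den ≫ u.hom) P.isPreStep_num (S.isPreStep_comp_aut P.isPreStep_den u)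
      (S.baseEquivalent_comp_unit P.base_eq hu) = f')
    (hdisj : S.DisjointSupports (S.div P.num) (S.div (P.den ≫ u.hom)))

/-- The twisted numerator is `s′`. [cite: MochizukiEtTh2009, Def 4.1 (i) p.312 (PDF p.86)] -/
@[simp] theorem twistUnit_num : (P.twistUnit u hu hfrac hdisj).num = P.num := rfl

/-- The twisted denominator is `u ∘ s″` (diagrammatic `s″ ≫ u`). [cite: MochizukiEtTh2009, Def 4.1 (i) p.312 (PDF p.86)] -/
@[simp] theorem twistUnit_den : (P.twistUnit u hu hfrac hdisj).den = P.den ≫ u.hom := rfl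

end

end FractionPair

/-! ### §3. `NthRoot.twistUnit`: twisting a root by a unit `ũ` of `B_N` OVER `u` -/

namespace NthRoot

section

variable {A B : S.C} {f : S.biratUnits A} {P : S.FractionPair f B} {N : ℕ+}
    {pullFrac : ∀ {A A' : S.C} (_ : A' ⟶ A), S.biratUnits A → S.biratUnits A'}
    (R : S.NthRoot f P N pullFrac) (u : Aut B) (hu : u ∈ S.units B)
    {f' : S.biratUnits A}
    (hfrac : S.fracOf P.num (P.den ≫ u.hom) P.isPreStep_num (S.isPreStep_comp_aut P.isPreStep_den u)
      (S.baseEquivalent_comp_unit P.base_eq hu) = f')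
    (hdisj : S.DisjointSupports (S.div P.num) (S.div (P.den ≫ u.hom)))
    (ut : Aut R.BN) (hut : ut ∈ S.units R.BN) (hover : ut.hom ≫ R.β = R.β ≫ u.hom)
    {root' : S.biratUnits R.AN}
    (hfracN : S.fracOf R.pair.num (R.pair.den ≫ ut.hom) R.pair.isPreStep_num
      (S.isPreStep_comp_aut R.pair.isPreStep_den ut) (S.baseEquivalent_comp_unit R.pair.base_eq hut) = root')
    (hdisjN : S.DisjointSupports (S.div R.pair.num) (S.div (R.pair.den ≫ ut.hom)))
    (hpow : root' ^ (N : ℕ) = pullFrac R.αData.α₁ f')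
    (hsat : S.IsSaturated R.AN N (pullFrac R.αData.α₁ f'))

/-- **The twist of an `N`-th root by a unit `ũ ∈ O^×(B_N)` lying over `u ∈ O^×(B)`** (`hover : ũ ≫ β = β ≫ u`): the root
`(A_N, B_N, α, β, f′_N, (s′_N, ũ ∘ s″_N))` of the twisted pair `(s′, u ∘ s″)` — the square `(ũ ∘ s″_N) ≫ β = α ≫ (u ∘ s″)`
PROVED from `hover` and `R.comm_den`; `α, β`, their isometry/degree clauses and the Def 4.1 (iv) data UNCHANGED; the
birational clauses "`f′_N := s′_N·(ũ ∘ s″_N)⁻¹`", "`f′_N^N = (α′)^* f′`", "`A_N` is `(N, H_⊙, (α′)^* f′)`-saturated" are the binders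
`hfracN`, `hpow`, `hsat` (abc-iut-L2-d4's `hroot₁N` in birational form: `ũ` an `N`-th root of `u` along the degree-`N` isometry `β`).
[cite: MochizukiEtTh2009, Prop 4.2 (iii) p.314 (PDF p.88); Lem 5.8 p.331 (PDF p.105)] -/
def twistUnit : S.NthRoot f' (P.twistUnit u hu hfrac hdisj) N pullFrac where
  AN := R.AN
  BN := R.BN
  α := R.α
  β := R.β
  root := root'
  pair := R.pair.twistUnit ut hut hfracN hdisjN
  comm_num := R.comm_num
  comm_den := by
    show (R.pair.den ≫ ut.hom) ≫ R.β = R.α ≫ P.den ≫ u.hom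
    rw [Category.assoc, hover, ← Category.assoc, R.comm_den, Category.assoc]
  isIsometry := R.isIsometry
  αData := R.αData
  pow_root := hpow
  isSaturated := hsat

/-- `N`-domain unchanged. [cite: MochizukiEtTh2009, Prop 4.2 (iii) p.314 (PDF p.88)] -/
@[simp] theorem twistUnit_AN : (R.twistUnit u hu hfrac hdisj ut hut hover hfracN hdisjN hpow hsat).AN = R.AN := rfl

/-- `N`-codomain unchanged. [cite: MochizukiEtTh2009, Prop 4.2 (iii) p.314 (PDF p.88)] -/
@[simp] theorem twistUnit_BN : (R.twistUnit u hu hfrac hdisj ut hut hover hfracN hdisjN hpow hsat).BN = R.BN := rfl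

/-- `α` unchanged. [cite: MochizukiEtTh2009, Prop 4.2 (iii) p.314 (PDF p.88)] -/
@[simp] theorem twistUnit_α : (R.twistUnit u hu hfrac hdisj ut hut hover hfracN hdisjN hpow hsat).α = R.α := rfl

/-- `β` unchanged. [cite: MochizukiEtTh2009, Prop 4.2 (iii) p.314 (PDF p.88)] -/
@[simp] theorem twistUnit_β : (R.twistUnit u hu hfrac hdisj ut hut hover hfracN hdisjN hpow hsat).β = R.β := rfl

/-- `f′_N` is the named twisted root. [cite: MochizukiEtTh2009, Prop 4.2 (iii) p.314 (PDF p.88)] -/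
@[simp] theorem twistUnit_root : (R.twistUnit u hu hfrac hdisj ut hut hover hfracN hdisjN hpow hsat).root = root' := rfl

/-- `s′_N` unchanged. [cite: MochizukiEtTh2009, Prop 4.2 (iii) p.314 (PDF p.88)] -/
@[simp] theorem twistUnit_pair_num :
    (R.twistUnit u hu hfrac hdisj ut hut hover hfracN hdisjN hpow hsat).pair.num = R.pair.num := rfl

/-- `s″_N ↦ ũ ∘ s″_N`. [cite: MochizukiEtTh2009, Prop 4.2 (iii) p.314 (PDF p.88)] -/
@[simp] theorem twistUnit_pair_den :
    (R.twistUnit u hu hfrac hdisj ut hut hover hfracN hdisjN hpow hsat).pair.den = R.pair.den ≫ ut.hom := rfl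

/-- Def 4.1 (iv) data unchanged. [cite: MochizukiEtTh2009, Def 4.1 (iv) p.313 (PDF p.87)] -/
@[simp] theorem twistUnit_αData :
    (R.twistUnit u hu hfrac hdisj ut hut hover hfracN hdisjN hpow hsat).αData = R.αData := rfl

end

end NthRoot

end BiKummerSetting

end Literature.AnabelianGeometry.EtaleTheta

end
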